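import Summits.QuantumFields.BalabanUV.Beta.FP.TowerQN1RowJet
import Summits.QuantumFields.BalabanUV.Beta.FP.TorusCompositeIndexWardTwoSym

/-!
# `BalabanUV.Beta.FP.TowerQN2RowJet` — road «FP», binder row D1, ROUTE T (β1), (E4e²) PART 1: **THE END WRAPPER's SYMMETRISED SECOND-ORDER 𝔔-SIDE SPLIT IS leaf-02
# TwoPolar-Sym's (n+2)-FOLD COMPOSITE BI-JET, AND — BY an2 g67's ORDER-2 SYM PURE-GAUGE LAW — THE SYMMETRISED CONJUGATED SECOND JET RUNS ALONG THE TWO GAUGE-COMPLETED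
# DIRECTIONS `hv v + tgrad·lv v`, `hv v′ + tgrad·lv v′` (NO GAUGE RESIDUE), HENCE ALONG `r • colN̂_a`, `r • colN̂_{a′}`** — the order-2 twin of `FP/TowerQN1RowJet`

WHY (`HOME/b2b-balaban-beta-d1-p3/g42/SPEC-54.md` §1–§2; an2 g66 J-NOTE-5 l.67629).  v4's row `hQN₂` (`FP/StepRecursionFeedNestedNamedC` l.282) reads the SYMMETRISED
conjugated second jet `½ • (𝔔′₂f v v′ + 𝔔′₂f v′ v)`.  §1 ADAPTS (with credit) the row's NOT-TO-FILE certificate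
`HOME/b2b-balaban-beta-an2/gen66/cert/J5-Qside-order2-chain-is-compIns22Sym.NOT-TO-FILE.lean` 8b9774e4e6ac1a79 (a₂): the symmetrised SPLIT `½ • (𝔔₂f v v′ + 𝔔₂f v′ v)` IS
`c² • compIns₂₂Sym … (n+2) (hv v) (hv v′)` (v4's un-symmetrised `𝔔₂f v v′` carries `Q₂₁f v·Q₁₁f v′` twice — equal to the bi-jet after symmetrisation only).  §2 is the
order-2 GAUGE STEP as pure algebra: with R-FP-79's read-out instantiated as in `TowerQN1RowJet` (`Xbf v := c • diagonal (lv v ∘ itRoot^{ρ_c} (n+2) ∘ fst)`), v4's `h𝔔′₂f`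
(l.189, VERBATIM) symmetrised equals `c² •` the bi-jet along the two gauge-completed directions AS SOON AS the bi-jet obeys the ORDER-2 SYM PURE-GAUGE LAW
**(W2-Sym) `compIns₂₂Sym … n h (tgrad·λ) = diagonal (λ ∘ itRoot^{ρ_c} n ∘ fst) · compIns₁Sym … n h − compIns₁Sym … n h · diagonal (λ ∘ fst)`** (one pure-gauge argument:
the commutator of the FIRST jet with the diagonal gauge generators; its `h := tgrad·λ′` instance with an2 g66's order-1 law gives the gauge–gauge term, so ONE law suffices) —
an2 g67's `FP/TorusCompositeIndexWardTwoSym.compIns₂₂Sym_pureGauge_snd` (INTENT-1 l.67660, the (β1) twin of leaf-02 g26's rooted `TorusCompositeIndexWardTwo`, typed the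
same hour; the row's J-NOTE-6 cert `gen67/cert/J6-Qside-order2-conjugation.NOT-TO-FILE.lean` d5262389f1b59a18 reaches §2's algebra independently — credit both ways).
§3: along two pinned directions `r•e_a`, `r•e_{a′}` the symmetrised conjugated second jet is `(c²·r·r) •` the bi-jet along the two torus ℋ-columns ((J-W″) as a sum,
`TowerQN1RowJet.direction_add_exact_eq_smul_col`, + bilinearity).  The junction with F5-Sym, the slot bridges, the double fold and the second-order lock rows are NOT here
(SPEC-54 §3–§5: `FP/TowerQN2Row`, after the row's PARTs).

WHAT ([folklore] `Matrix`∕`Finset` bookkeeping BY NAME; no `def`, no `def … : Prop`, nothing cited, 0 sorry): §1 **`Qf2_symm_eq_compIns22Sym`** (an2 J-NOTE-5 (a₂), adapted,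
source type `κ` generic); §2 **`Qprime2_symm_eq_bijet_along_sums_of_pureGauge`** (abstract first jet `CI`, rows `CRS`, bi-jet `CB` with `hPG₁ ∕ hPG₂ ∕ hBaddl ∕ hBaddr ∕ hBcomm`),
**`Qprime2_symm_eq_compIns22Sym_along_sums`** (concrete: `hPG₁` DISCHARGED by an2 g66 `compIns₁Sym_pureGauge_fun`, `hPG₂` by an2 g67 `compIns₂₂Sym_pureGauge_snd`, additivity ∕
symmetry by leaf-02 TwoPolar-Sym — all read at the wrapper's spelling `towerTorus Lc (fine Lc M) (n+1)` of `towerTorus Lc M (n+2)`); §3 **`Qprime2_symm_eq_smul_compIns22Sym_cols`**.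
WHAT THIS IS NOT: not `hQN₂` (the junction with F5-Sym, the slot bridges, the fold, the locks: `FP/TowerQN2Row`); nothing of Bałaban's asserted, valued or discharged;
0 estimates; 0∕4 row-D1 binders
(hW, hR, D1Tel, D1Rep); ROOT M‴ p325680 ∕ P5c ∕ D6 untouched; NOT (C1), NOT (L2′), NOT (T-ID), NOT SDF, NOT D1, NEVER «G-an2-4 closed», NOT BetaPertH, NOT continuum, NOT Clay.

HONEST DEPENDENCY (page 1, mandatory): continuum YM on T⁴ ⇐ BetaPertH ∧ nine spine estimates (0/9 proved); BetaPertH ⇐ (D1) ∧ (D4) ∧ CAP+tail;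
G-an2-4 gates asym, D1 and NE2/3/4.  HONEST FRAMING (cell contract, verbatim): «discharging `BetaPertH` makes Bałaban's UV stability UNCONDITIONAL —
a real constructive-QFT result; it is NOT the continuum limit and NOT the Clay problem.»  ABSOLUTE RULE (cell charter, verbatim): «No internally-minted
statement may enter as a cited fact. Every hypothesis is either kernel-proved in this package or a verbatim quotation of a PUBLISHED theorem with page
reference. The manuscript(s) under audit are NOT citable for their own disputed steps — they are the thing under adjudication; programme-internal
(2001/route/tribunal) claims are never citable.»  Road «FP» OWNER, b2b-balaban-beta-d1-p3 gen 42, 2026-08-27.  No existing file touched.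
-/

noncomputable section

open scoped BigOperators

namespace Summit.QuantumFields.BalabanUV.Beta.FP.TowerQN2RowJet

open Finset Matrix
open Literature.MathematicalPhysics.QuantumFieldTheory
open Literature.MathematicalPhysics.QuantumFieldTheory.Balaban1983to89
open Literature.MathematicalPhysics.QuantumFieldTheory.Balaban1983to89.Beta
open B4TorusKernel.MultiPeriod (translate)
open B5Prop11Plancherel (fine)
open B6Lemma24Torus (pbox)
open AffineAveraging (Site box toSite)
open AveragingContoursRooted (ctr ctrOff)
open OneStepResolventKernel (Fib)
open Summit.QuantumFields.BalabanUV.Beta.BorderedHessian (stepScale)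
open Summit.QuantumFields.BalabanUV.Beta.SymShiftedSpread (bhKStepSh)
open Summit.QuantumFields.BalabanUV.Beta.DshAn1 (Dsh)
open Summit.QuantumFields.BalabanUV.Beta.SymAveragingHessianCounts (symVhSAt)
open Summit.QuantumFields.BalabanUV.Beta.CompositeOneShotJetData (Roots Pins AN VN)
open Summit.QuantumFields.BalabanUV.Beta.FP.KernelPeriodisationFib (Idx perF)
open Summit.QuantumFields.BalabanUV.Beta.FP.KernelPeriodisationFibLoc (dper)
open Summit.QuantumFields.BalabanUV.Beta.FP.TorusGaugeCovariance (tgrad)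
open Summit.QuantumFields.BalabanUV.Beta.FP.TorusGaugeCovariancePairing (wrapPt)
open Summit.QuantumFields.BalabanUV.Beta.FP.TorusGaugeCovarianceCoarse (coarsePt)
open Summit.QuantumFields.BalabanUV.Beta.FP.TorusCompositeObjects (towerTorus)
open Summit.QuantumFields.BalabanUV.Beta.FP.TorusCompositeObjectsG (QstepSym compRowsSym)
open Summit.QuantumFields.BalabanUV.Beta.FP.TorusCompositeCovariance (itRoot)
open Summit.QuantumFields.BalabanUV.Beta.FP.TorusStepInsertionSym (stepIns₁Sym)
open Summit.QuantumFields.BalabanUV.Beta.FP.TorusCompositeCovarianceOneSym (compIns₁Sym)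
open Summit.QuantumFields.BalabanUV.Beta.FP.TorusCompositeIndexWardOneSym (compIns₁Sym_pureGauge_fun)
open Summit.QuantumFields.BalabanUV.Beta.FP.TorusCompositeIndexWardTwoSym (compIns₂₂Sym_pureGauge_snd)
open Summit.QuantumFields.BalabanUV.Beta.SymAveragingMixedJetTables (symVh₂SAt)
open Summit.QuantumFields.BalabanUV.Beta.FP.TorusStepInsertionSymTwo (stepIns₂₂Sym)
open Summit.QuantumFields.BalabanUV.Beta.FP.TorusCompositeCovarianceOne (prod_stepScale_mul_card_ne_zero')
open Summit.QuantumFields.BalabanUV.Beta.FP.TorusCompositeCovarianceTwoPolarSym (compIns₂₂Sym compIns₂₂Sym_comm compIns₂₂Sym_add_left compIns₂₂Sym_add_right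
  compIns₂₂Sym_smul_left compIns₂₂Sym_smul_right stepIns₂₂Sym_comm stepIns₂₂Sym_smul_left stepIns₂₂Sym_smul_right stepIns₁Sym_smul)
open Summit.QuantumFields.BalabanUV.Beta.FP.TowerQN1RowJet (direction_add_exact_eq_smul_col)

variable {Lc : ℕ} [NeZero Lc] (M : Fin (3 + 1) → ℕ) [∀ μ, NeZero (M μ)] (n : ℕ) (c : ℝ)


/-! ## §1 The symmetrised second-order 𝔔-side split IS the (n+2)-fold composite bi-jet (an2 g66 J-NOTE-5 (a₂), adapted) -/

section Letters

variable (hc : ctrOff (3 + 1) Lc ∈ box (3 + 1) Lc) {κ : Type*}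
  -- v4's 𝔔-side letters VERBATIM (`Mc B ↦ M`, `c n ↦ c`, `hv n B ↦ hv`; the source type `κ B ↦ κ`), first AND second order
  (Q₁₀ : Matrix (↥(pbox (fine Lc M)) × Fin (3 + 1)) (↥(pbox (towerTorus Lc (fine Lc M) (n + 1))) × Fin (3 + 1)) ℝ)
  (hQ₁₀ : Q₁₀ = compRowsSym Lc (fine Lc M) (fun i : ℕ => n + 1 - i) (fun _ : ℕ => ctrOff (3 + 1) Lc) (n + 1))
  (Q₂₀ : Matrix (↥(pbox M) × Fin (3 + 1)) (↥(pbox (fine Lc M)) × Fin (3 + 1)) ℝ)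
  (hQ₂₀ : Q₂₀ = (perF (fine Lc M) (bhKStepSh 3 Lc (Dsh Lc) ((n + 1 - 0)))).submatrix
    (fun a : ((↥(pbox M) × Fin (3 + 1))) => ((coarsePt M Lc a.1, Sum.inr (a.2)) : Idx (fine Lc M) (Fib 3)))
    (fun b : (↥(pbox (fine Lc M)) × Fin (3 + 1)) => ((b.1, Sum.inl b.2) : Idx (fine Lc M) (Fib 3))))
  (hv : (κ → ℝ) → (↥(pbox (towerTorus Lc (fine Lc M) (n + 1))) × Fin (3 + 1) → ℝ))
  (Q₁₁f : (κ → ℝ) → Matrix (↥(pbox (fine Lc M)) × Fin (3 + 1)) (↥(pbox (towerTorus Lc (fine Lc M) (n + 1))) × Fin (3 + 1)) ℝ)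
  (hQ₁₁f : ∀ v, Q₁₁f v = c • compIns₁Sym Lc (fine Lc M) (fun i : ℕ => n + 1 - i) (fun _ : ℕ => ctrOff (3 + 1) Lc) (n + 1) (hv v))
  (Q₂₁f : (κ → ℝ) → Matrix ((↥(pbox M) × Fin (3 + 1))) (↥(pbox (fine Lc M)) × Fin (3 + 1)) ℝ)
  (hQ₂₁f : ∀ v, Q₂₁f v = ∑ a' : (↥(pbox (fine Lc M)) × Fin (3 + 1)), ((c * (((Lc : ℝ) ^ (3 + 1) * stepScale 3 Lc ((n + 1 - 0))) *
      (∏ i ∈ range (n + 1), (stepScale 3 Lc ((n + 1 - (i + 1))) * ((box (3 + 1) Lc).card : ℝ)))⁻¹)) *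
      (compRowsSym Lc (fine Lc M) (fun i : ℕ => n + 1 - i) (fun _ : ℕ => ctrOff (3 + 1) Lc) (n + 1) *ᵥ (hv v)) a') •
      (perF (fine Lc M) (dper (fine Lc M) (symVhSAt (ctr (3 + 1) Lc) 3 Lc rfl a'.2 (a'.1 : Site (3 + 1))))).submatrix
        (fun k : (↥(pbox M) × Fin (3 + 1)) => (((coarsePt M Lc k.1, Sum.inr (k.2)) : Idx (fine Lc M) (Fib 3))))
        (fun b : (↥(pbox (fine Lc M)) × Fin (3 + 1)) => ((b.1, Sum.inl b.2) : Idx (fine Lc M) (Fib 3))))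
  (Q₁₂f : (κ → ℝ) → (κ → ℝ) → Matrix (↥(pbox (fine Lc M)) × Fin (3 + 1)) (↥(pbox (towerTorus Lc (fine Lc M) (n + 1))) × Fin (3 + 1)) ℝ)
  (hQ₁₂f : ∀ v v', Q₁₂f v v' = c ^ 2 • compIns₂₂Sym Lc (fine Lc M) (fun i : ℕ => n + 1 - i) (fun _ : ℕ => ctrOff (3 + 1) Lc) (n + 1) (hv v) (hv v'))
  (Q₂₂f : (κ → ℝ) → (κ → ℝ) → Matrix ((↥(pbox M) × Fin (3 + 1))) (↥(pbox (fine Lc M)) × Fin (3 + 1)) ℝ)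
    (hQ₂₂f : ∀ v v', Q₂₂f v v' = ((Lc : ℝ) ^ (3 + 1) * stepScale 3 Lc ((n + 1 - 0)))⁻¹ •
        ∑ b : (↥(pbox (fine Lc M)) × Fin (3 + 1)), ∑ b' : (↥(pbox (fine Lc M)) × Fin (3 + 1)), (((c * (((Lc : ℝ) ^ (3 + 1) * stepScale 3 Lc ((n + 1 - 0))) * (∏ i ∈ range (n + 1), (stepScale 3 Lc ((n + 1 - (i + 1))) * ((box (3 + 1) Lc).card : ℝ)))⁻¹)) * (compRowsSym Lc (fine Lc M) (fun i : ℕ => n + 1 - i) (fun _ : ℕ => ctrOff (3 + 1) Lc) (n + 1) *ᵥ (hv v)) b) * ((c * (((Lc : ℝ) ^ (3 + 1) * stepScale 3 Lc ((n + 1 - 0))) * (∏ i ∈ range (n + 1), (stepScale 3 Lc ((n + 1 - (i + 1))) * ((box (3 + 1) Lc).card : ℝ)))⁻¹)) * (compRowsSym Lc (fine Lc M) (fun i : ℕ => n + 1 - i) (fun _ : ℕ => ctrOff (3 + 1) Lc) (n + 1) *ᵥ (hv v')) b')) •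
          (perF (fine Lc M) (dper (fine Lc M) (fun x z a e => ∑' m : Site (3 + 1), (1 / 2 : ℝ) *
            (symVh₂SAt (ctr (3 + 1) Lc) Lc b.2 (b.1 : Site (3 + 1)) b'.2 (translate (fine Lc M) (b'.1 : Site (3 + 1)) m) x z a e
              + symVh₂SAt (ctr (3 + 1) Lc) Lc b'.2 (translate (fine Lc M) (b'.1 : Site (3 + 1)) m) b.2 (b.1 : Site (3 + 1)) x z a e)))).submatrix
            (fun k : (↥(pbox M) × Fin (3 + 1)) => (((coarsePt M Lc k.1, Sum.inr (k.2)) : Idx (fine Lc M) (Fib 3)))) (fun b : (↥(pbox (fine Lc M)) × Fin (3 + 1)) => ((b.1, Sum.inl b.2) : Idx (fine Lc M) (Fib 3))))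
  (𝔔₂f : (κ → ℝ) → (κ → ℝ) → Matrix ((↥(pbox M) × Fin (3 + 1))) (↥(pbox (towerTorus Lc (fine Lc M) (n + 1))) × Fin (3 + 1)) ℝ)
  (h𝔔₂ : ∀ v v', Q₂₂f v v' * Q₁₀ + Q₂₁f v * Q₁₁f v' + (Q₂₁f v * Q₁₁f v' + Q₂₀ * Q₁₂f v v') = 𝔔₂f v v')

include hc hQ₁₀ hQ₂₀ hQ₁₁f hQ₂₁f hQ₁₂f hQ₂₂f h𝔔₂ in
/-- [folklore] **`Qf2_symm_eq_compIns22Sym`** (an2 g66 J-NOTE-5 (a₂), adapted with credit — the row's certificate VERBATIM up to the letters' packaging): the wrapper's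
second-order 𝔔-side split `h𝔔₂`, SYMMETRISED in the two directions (as `hQN₂` reads it, R-FP-80), IS `c² •` leaf-02 TwoPolar-Sym's (n+2)-fold composite bi-jet at
`lev := fun i => n+1−(i−1)` (top peel `compIns₂₂Sym_succ` by `rfl`; `Q₂₂f`'s double sum IS `stepIns₂₂Sym` of the two scaled transported directions and `Q₂₁f`'s sum IS
`stepIns₁Sym` of one, DEFINITIONALLY; bilinearity, the two symmetries at the LOWER depth, and `A⁻¹·(c·A·σ⁻¹)² = c²·(A·σ⁻¹)·σ⁻¹`). -/
theorem Qf2_symm_eq_compIns22Sym (v v' : κ → ℝ) :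
    (1 / 2 : ℝ) • (𝔔₂f v v' + 𝔔₂f v' v)
      = c ^ 2 • compIns₂₂Sym Lc M (fun i : ℕ => n + 1 - (i - 1)) (fun _ : ℕ => ctrOff (3 + 1) Lc) (n + 1 + 1) (hv v) (hv v') := by
  rw [← h𝔔₂, ← h𝔔₂, hQ₂₂f, hQ₂₂f, hQ₂₁f, hQ₂₁f, hQ₁₁f, hQ₁₁f, hQ₁₂f, hQ₁₂f, hQ₂₀, hQ₁₀]
  show (1 / 2 : ℝ) • ((((Lc : ℝ) ^ (3 + 1) * stepScale 3 Lc (n + 1 - 0))⁻¹ • stepIns₂₂Sym M Lc ((c * (((Lc : ℝ) ^ (3 + 1) * stepScale 3 Lc (n + 1 - 0)) * (∏ i ∈ range (n + 1), (stepScale 3 Lc (n + 1 - (i + 1)) * ((box (3 + 1) Lc).card : ℝ)))⁻¹)) • (compRowsSym Lc (fine Lc M) (fun i : ℕ => n + 1 - i) (fun _ : ℕ => ctrOff (3 + 1) Lc) (n + 1) *ᵥ hv v)) ((c * (((Lc : ℝ) ^ (3 + 1) * stepScale 3 Lc (n + 1 - 0)) * (∏ i ∈ range (n + 1), (stepScale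 3 Lc (n + 1 - (i + 1)) * ((box (3 + 1) Lc).card : ℝ)))⁻¹)) • (compRowsSym Lc (fine Lc M) (fun i : ℕ => n + 1 - i) (fun _ : ℕ => ctrOff (3 + 1) Lc) (n + 1) *ᵥ hv v')) * compRowsSym Lc (fine Lc M) (fun i : ℕ => n + 1 - i) (fun _ : ℕ => ctrOff (3 + 1) Lc) (n + 1)
        + stepIns₁Sym M Lc ((c * (((Lc : ℝ) ^ (3 + 1) * stepScale 3 Lc (n + 1 - 0)) * (∏ i ∈ range (n + 1), (stepScale 3 Lc (n + 1 - (i + 1)) * ((box (3 + 1) Lc).card : ℝ)))⁻¹)) • (compRowsSym Lc (fine Lc M) (fun i : ℕ => n + 1 - i) (fun _ : ℕ => ctrOff (3 + 1) Lc) (n + 1) *ᵥ hv v)) * (c • compIns₁Sym Lc (fine Lc M) (fun i : ℕ => n + 1 - i) (fun _ : ℕ => ctrOff (3 + 1) Lc) (n + 1) (hv v'))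
        + (stepIns₁Sym M Lc ((c * (((Lc : ℝ) ^ (3 + 1) * stepScale 3 Lc (n + 1 - 0)) * (∏ i ∈ range (n + 1), (stepScale 3 Lc (n + 1 - (i + 1)) * ((box (3 + 1) Lc).card : ℝ)))⁻¹)) • (compRowsSym Lc (fine Lc M) (fun i : ℕ => n + 1 - i) (fun _ : ℕ => ctrOff (3 + 1) Lc) (n + 1) *ᵥ hv v)) * (c • compIns₁Sym Lc (fine Lc M) (fun i : ℕ => n + 1 - i) (fun _ : ℕ => ctrOff (3 + 1) Lc) (n + 1) (hv v')) + QstepSym Lc M (n + 1 - 0) * (c ^ 2 • compIns₂₂Sym Lc (fine Lc M) (fun i : ℕ => n + 1 - i) (fun _ : ℕ => ctrOff (3 + 1) Lc) (n + 1) (hv v) (hv v'))))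
      + (((Lc : ℝ) ^ (3 + 1) * stepScale 3 Lc (n + 1 - 0))⁻¹ • stepIns₂₂Sym M Lc ((c * (((Lc : ℝ) ^ (3 + 1) * stepScale 3 Lc (n + 1 - 0)) * (∏ i ∈ range (n + 1), (stepScale 3 Lc (n + 1 - (i + 1)) * ((box (3 + 1) Lc).card : ℝ)))⁻¹)) • (compRowsSym Lc (fine Lc M) (fun i : ℕ => n + 1 - i) (fun _ : ℕ => ctrOff (3 + 1) Lc) (n + 1) *ᵥ hv v')) ((c * (((Lc : ℝ) ^ (3 + 1) * stepScale 3 Lc (n + 1 - 0)) * (∏ i ∈ range (n + 1), (stepScale 3 Lc (n + 1 - (i + 1)) * ((box (3 + 1) Lc).card : ℝ)))⁻¹)) • (compRowsSym Lc (fine Lc M) (fun i : ℕ => n + 1 - i) (fun _ : ℕ => ctrOff (3 + 1) Lc) (n + 1) *ᵥ hv v)) * compRowsSym Lc (fine Lc M) (fun i : ℕ => n + 1 - i) (fun _ : ℕ => ctrOff (3 + 1) Lc) (n + 1)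
        + stepIns₁Sym M Lc ((c * (((Lc : ℝ) ^ (3 + 1) * stepScale 3 Lc (n + 1 - 0)) * (∏ i ∈ range (n + 1), (stepScale 3 Lc (n + 1 - (i + 1)) * ((box (3 + 1) Lc).card : ℝ)))⁻¹)) • (compRowsSym Lc (fine Lc M) (fun i : ℕ => n + 1 - i) (fun _ : ℕ => ctrOff (3 + 1) Lc) (n + 1) *ᵥ hv v')) * (c • compIns₁Sym Lc (fine Lc M) (fun i : ℕ => n + 1 - i) (fun _ : ℕ => ctrOff (3 + 1) Lc) (n + 1) (hv v))
        + (stepIns₁Sym M Lc ((c * (((Lc : ℝ) ^ (3 + 1) * stepScale 3 Lc (n + 1 - 0)) * (∏ i ∈ range (n + 1), (stepScale 3 Lc (n + 1 - (i + 1)) * ((box (3 + 1) Lc).card : ℝ)))⁻¹)) • (compRowsSym Lc (fine Lc M) (fun i : ℕ => n + 1 - i) (fun _ : ℕ => ctrOff (3 + 1) Lc) (n + 1) *ᵥ hv v')) * (c • compIns₁Sym Lc (fine Lc M) (fun i : ℕ => n + 1 - i) (fun _ : ℕ => ctrOff (3 + 1) Lc) (n + 1) (hv v)) + QstepSym Lc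 M (n + 1 - 0) * (c ^ 2 • compIns₂₂Sym Lc (fine Lc M) (fun i : ℕ => n + 1 - i) (fun _ : ℕ => ctrOff (3 + 1) Lc) (n + 1) (hv v') (hv v)))))
    = c ^ 2 • (((((Lc : ℝ) ^ (3 + 1) * stepScale 3 Lc (n + 1 - 0)) * (∏ i ∈ range (n + 1), (stepScale 3 Lc (n + 1 - (i + 1)) * ((box (3 + 1) Lc).card : ℝ)))⁻¹) * (∏ i ∈ range (n + 1), (stepScale 3 Lc (n + 1 - (i + 1)) * ((box (3 + 1) Lc).card : ℝ)))⁻¹) • (stepIns₂₂Sym M Lc (compRowsSym Lc (fine Lc M) (fun i : ℕ => n + 1 - i) (fun _ : ℕ => ctrOff (3 + 1) Lc) (n + 1) *ᵥ hv v) (compRowsSym Lc (fine Lc M) (fun i : ℕ => n + 1 - i) (fun _ : ℕ => ctrOff (3 + 1) Lc) (n + 1) *ᵥ hv v') * compRowsSym Lc (fine Lc M) (fun i : ℕ => n + 1 - i) (fun _ : ℕ => ctrOff (3 + 1) Lc) (n + 1))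
          + (((Lc : ℝ) ^ (3 + 1) * stepScale 3 Lc (n + 1 - 0)) * (∏ i ∈ range (n + 1), (stepScale 3 Lc (n + 1 - (i + 1)) * ((box (3 + 1) Lc).card : ℝ)))⁻¹) • (stepIns₁Sym M Lc (compRowsSym Lc (fine Lc M) (fun i : ℕ => n + 1 - i) (fun _ : ℕ => ctrOff (3 + 1) Lc) (n + 1) *ᵥ hv v) * compIns₁Sym Lc (fine Lc M) (fun i : ℕ => n + 1 - i) (fun _ : ℕ => ctrOff (3 + 1) Lc) (n + 1) (hv v') + stepIns₁Sym M Lc (compRowsSym Lc (fine Lc M) (fun i : ℕ => n + 1 - i) (fun _ : ℕ => ctrOff (3 + 1) Lc) (n + 1) *ᵥ hv v') * compIns₁Sym Lc (fine Lc M) (fun i : ℕ => n + 1 - i) (fun _ : ℕ => ctrOff (3 + 1) Lc) (n + 1) (hv v))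
          + QstepSym Lc M (n + 1 - 0) * compIns₂₂Sym Lc (fine Lc M) (fun i : ℕ => n + 1 - i) (fun _ : ℕ => ctrOff (3 + 1) Lc) (n + 1) (hv v) (hv v'))
  have hA0 : ((Lc : ℝ) ^ (3 + 1) * stepScale 3 Lc (n + 1 - 0)) ≠ 0 :=
    mul_ne_zero (pow_ne_zero _ (by exact_mod_cast NeZero.ne Lc)) (Summit.QuantumFields.BalabanUV.Beta.BorderedHessian.stepScale_ne_zero _)
  have hσ0 : (∏ i ∈ range (n + 1), (stepScale 3 Lc (n + 1 - (i + 1)) * ((box (3 + 1) Lc).card : ℝ))) ≠ 0 :=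
    prod_stepScale_mul_card_ne_zero' Lc ⟨ctrOff (3 + 1) Lc, hc⟩ (fun i => n + 1 - (i + 1)) (n + 1)
  simp only [stepIns₁Sym_smul, stepIns₂₂Sym_smul_left, stepIns₂₂Sym_smul_right]
  rw [stepIns₂₂Sym_comm M Lc hc (compRowsSym Lc (fine Lc M) (fun i : ℕ => n + 1 - i) (fun _ : ℕ => ctrOff (3 + 1) Lc) (n + 1) *ᵥ hv v') (compRowsSym Lc (fine Lc M) (fun i : ℕ => n + 1 - i) (fun _ : ℕ => ctrOff (3 + 1) Lc) (n + 1) *ᵥ hv v),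
    compIns₂₂Sym_comm Lc hc (n + 1) (fine Lc M) (fun i : ℕ => n + 1 - i) (fun _ : ℕ => ctrOff (3 + 1) Lc) (hv v') (hv v)]
  generalize hAdef : ((Lc : ℝ) ^ (3 + 1) * stepScale 3 Lc (n + 1 - 0)) = A at hA0 ⊢
  generalize hSdef : (∏ i ∈ range (n + 1), (stepScale 3 Lc (n + 1 - (i + 1)) * ((box (3 + 1) Lc).card : ℝ))) = S at hσ0 ⊢
  simp only [smul_smul, Matrix.smul_mul, Matrix.mul_smul, smul_add]
  match_scalars <;> field_simp <;> ring

end Letters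


/-! ## §2 The order-2 gauge step: the symmetrised conjugated second jet is the bi-jet along the two gauge-completed directions -/

section Gauge

variable (hc : ctrOff (3 + 1) Lc ∈ box (3 + 1) Lc) {κ : Type*}
  (hv : (κ → ℝ) → (↥(pbox (towerTorus Lc (fine Lc M) (n + 1))) × Fin (3 + 1) → ℝ))
  (lv : (κ → ℝ) → (↥(pbox (towerTorus Lc (fine Lc M) (n + 1))) → ℝ))
  (𝔔₀ CRS : Matrix ((↥(pbox M) × Fin (3 + 1))) (↥(pbox (towerTorus Lc (fine Lc M) (n + 1))) × Fin (3 + 1)) ℝ)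
  (h𝔔₀' : 𝔔₀ = CRS)
  -- an abstract first jet `CI` and bi-jet `CB` (instantiated in `Qprime2_symm_eq_compIns22Sym_along_sums` as leaf-02's `compIns₁Sym ∕ compIns₂₂Sym … (n+2)`)
  (CI : (↥(pbox (towerTorus Lc (fine Lc M) (n + 1))) × Fin (3 + 1) → ℝ) →
    Matrix ((↥(pbox M) × Fin (3 + 1))) (↥(pbox (towerTorus Lc (fine Lc M) (n + 1))) × Fin (3 + 1)) ℝ)
  (𝔔₁f : (κ → ℝ) → Matrix ((↥(pbox M) × Fin (3 + 1))) (↥(pbox (towerTorus Lc (fine Lc M) (n + 1))) × Fin (3 + 1)) ℝ)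
  (h𝔔₁' : ∀ v, 𝔔₁f v = c • CI (hv v))
  (CB : (↥(pbox (towerTorus Lc (fine Lc M) (n + 1))) × Fin (3 + 1) → ℝ) → (↥(pbox (towerTorus Lc (fine Lc M) (n + 1))) × Fin (3 + 1) → ℝ) →
    Matrix ((↥(pbox M) × Fin (3 + 1))) (↥(pbox (towerTorus Lc (fine Lc M) (n + 1))) × Fin (3 + 1)) ℝ)
  (𝔔₂f : (κ → ℝ) → (κ → ℝ) → Matrix ((↥(pbox M) × Fin (3 + 1))) (↥(pbox (towerTorus Lc (fine Lc M) (n + 1))) × Fin (3 + 1)) ℝ)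
  (h𝔔₂' : ∀ v v', (1 / 2 : ℝ) • (𝔔₂f v v' + 𝔔₂f v' v) = c ^ 2 • CB (hv v) (hv v'))
  (Xbf : (κ → ℝ) → Matrix ((↥(pbox M) × Fin (3 + 1))) ((↥(pbox M) × Fin (3 + 1))) ℝ)
  -- THE INSTANTIATION of R-FP-79's free coarse read-out (as `TowerQN1RowJet`): the gauge function at the iterated CENTRED root of the coarse slot
  (hXbf : ∀ v, Xbf v = c • Matrix.diagonal (fun a : (↥(pbox M) × Fin (3 + 1)) =>
    lv v (itRoot Lc M (fun _ : ℕ => ctrOff (3 + 1) Lc) (fun _ => hc) (n + 1 + 1) a.1)))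
  -- v4's SECOND-ORDER CONJUGATION `h𝔔'₂f` VERBATIM (`FP/StepRecursionFeedNestedNamedC` l.189; `X v := −(c • diagonal (lv v ∘ fst))` spelled out as there)
  (𝔔'₂f : (κ → ℝ) → (κ → ℝ) → Matrix ((↥(pbox M) × Fin (3 + 1))) (↥(pbox (towerTorus Lc (fine Lc M) (n + 1))) × Fin (3 + 1)) ℝ)
  (h𝔔'₂f : ∀ v v', 𝔔'₂f v v' = Xbf v * Xbf v' * 𝔔₀ + (Xbf v * 𝔔₁f v' + Xbf v * 𝔔₀ * (-(c • Matrix.diagonal (fun b : (↥(pbox (towerTorus Lc (fine Lc M) (n + 1))) × Fin (3 + 1)) => lv v' b.1))))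
      + ((Xbf v * 𝔔₁f v' + Xbf v * 𝔔₀ * (-(c • Matrix.diagonal (fun b : (↥(pbox (towerTorus Lc (fine Lc M) (n + 1))) × Fin (3 + 1)) => lv v' b.1)))) + (𝔔₂f v v' + 𝔔₁f v * (-(c • Matrix.diagonal (fun b : (↥(pbox (towerTorus Lc (fine Lc M) (n + 1))) × Fin (3 + 1)) => lv v' b.1))) + (𝔔₁f v * (-(c • Matrix.diagonal (fun b : (↥(pbox (towerTorus Lc (fine Lc M) (n + 1))) × Fin (3 + 1)) => lv v' b.1))) + 𝔔₀ * ((-(c • Matrix.diagonal (fun b : (↥(pbox (towerTorus Lc (fine Lc M) (n + 1))) × Fin (3 + 1)) => lv v b.1))) * (-(c • Matrix.diagonal (fun b : (↥(pbox (towerTorus Lc (fine Lc M) (n + 1))) × Fin (3 + 1)) => lv v' b.1))))))))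

omit [NeZero Lc] [∀ μ, NeZero (M μ)] in
include h𝔔₀' h𝔔₁' h𝔔₂' hXbf h𝔔'₂f in
/-- [folklore] **`Qprime2_symm_eq_bijet_along_sums_of_pureGauge` — THE ORDER-2 GAUGE STEP AS PURE ALGEBRA**: GIVEN an abstract first jet `CI` with rows `CRS = 𝔔₀` obeying the
order-1 pure-gauge law `hPG₁` (`CI (tgrad·λ) = R_λ·CRS − CRS·E_λ`), and an abstract bi-jet `CB`, additive in both weights (`hBaddl ∕ hBaddr`), symmetric (`hBcomm`) and obeying
THE ORDER-2 PURE-GAUGE LAW **`hPG₂ : CB h (tgrad·λ) = R_λ·CI h − CI h·E_λ`** (`R_λ = diagonal (λ ∘ itRoot^{ρ_c} (n+2) ∘ fst)`, `E_λ = diagonal (λ ∘ fst)`), v4's conjugated second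
jet, SYMMETRISED, is `c² • CB (hv v + tgrad·lv v) (hv v′ + tgrad·lv v′)`: expand the right side by bilinearity into the four blocks `CB h h′`, `CB h (Dλ′)`, `CB (Dλ) h′`,
`CB (Dλ) (Dλ′)`; the last is `R_{λ′}·CI (Dλ) − CI (Dλ)·E_{λ′}` by `hPG₂` and then `hPG₁` — so the gauge–gauge block `R R′ C − R C E′ − R′ C E + C E E′` of `h𝔔′₂f` needs NO
separate law; the diagonal generators commute (`diagonal_mul_diagonal`). -/
theorem Qprime2_symm_eq_bijet_along_sums_of_pureGauge
    (hPG₁ : ∀ lam : ↥(pbox (towerTorus Lc (fine Lc M) (n + 1))) → ℝ,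
      CI (fun b : ↥(pbox (towerTorus Lc (fine Lc M) (n + 1))) × Fin (3 + 1) =>
          ∑ s : ↥(pbox (towerTorus Lc (fine Lc M) (n + 1))), tgrad (towerTorus Lc (fine Lc M) (n + 1)) (b.1, Sum.inl b.2) s * lam s)
        = Matrix.diagonal (fun a : ↥(pbox M) × Fin (3 + 1) => lam (itRoot Lc M (fun _ : ℕ => ctrOff (3 + 1) Lc) (fun _ => hc) (n + 1 + 1) a.1)) * CRS
          - CRS * Matrix.diagonal (fun b : ↥(pbox (towerTorus Lc (fine Lc M) (n + 1))) × Fin (3 + 1) => lam b.1))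
    (hPG₂ : ∀ (h : ↥(pbox (towerTorus Lc (fine Lc M) (n + 1))) × Fin (3 + 1) → ℝ) (lam : ↥(pbox (towerTorus Lc (fine Lc M) (n + 1))) → ℝ),
      CB h (fun b : ↥(pbox (towerTorus Lc (fine Lc M) (n + 1))) × Fin (3 + 1) =>
          ∑ s : ↥(pbox (towerTorus Lc (fine Lc M) (n + 1))), tgrad (towerTorus Lc (fine Lc M) (n + 1)) (b.1, Sum.inl b.2) s * lam s)
        = Matrix.diagonal (fun a : ↥(pbox M) × Fin (3 + 1) => lam (itRoot Lc M (fun _ : ℕ => ctrOff (3 + 1) Lc) (fun _ => hc) (n + 1 + 1) a.1)) * CI h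
          - CI h * Matrix.diagonal (fun b : ↥(pbox (towerTorus Lc (fine Lc M) (n + 1))) × Fin (3 + 1) => lam b.1))
    (hBaddl : ∀ h₁ h₂ h' : ↥(pbox (towerTorus Lc (fine Lc M) (n + 1))) × Fin (3 + 1) → ℝ, CB (h₁ + h₂) h' = CB h₁ h' + CB h₂ h')
    (hBaddr : ∀ h h₁ h₂ : ↥(pbox (towerTorus Lc (fine Lc M) (n + 1))) × Fin (3 + 1) → ℝ, CB h (h₁ + h₂) = CB h h₁ + CB h h₂)
    (hBcomm : ∀ h h' : ↥(pbox (towerTorus Lc (fine Lc M) (n + 1))) × Fin (3 + 1) → ℝ, CB h h' = CB h' h)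
    (v v' : κ → ℝ) :
    (1 / 2 : ℝ) • (𝔔'₂f v v' + 𝔔'₂f v' v)
      = c ^ 2 • CB (hv v + fun b : ↥(pbox (towerTorus Lc (fine Lc M) (n + 1))) × Fin (3 + 1) =>
            ∑ s : ↥(pbox (towerTorus Lc (fine Lc M) (n + 1))), tgrad (towerTorus Lc (fine Lc M) (n + 1)) (b.1, Sum.inl b.2) s * lv v s)
          (hv v' + fun b : ↥(pbox (towerTorus Lc (fine Lc M) (n + 1))) × Fin (3 + 1) =>
            ∑ s : ↥(pbox (towerTorus Lc (fine Lc M) (n + 1))), tgrad (towerTorus Lc (fine Lc M) (n + 1)) (b.1, Sum.inl b.2) s * lv v' s) := by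
  -- the bi-jet with a pure gauge in the FIRST slot (symmetry + `hPG₂`)
  have hPG₂' : ∀ (lam : ↥(pbox (towerTorus Lc (fine Lc M) (n + 1))) → ℝ) (h : ↥(pbox (towerTorus Lc (fine Lc M) (n + 1))) × Fin (3 + 1) → ℝ),
      CB (fun b : ↥(pbox (towerTorus Lc (fine Lc M) (n + 1))) × Fin (3 + 1) =>
          ∑ s : ↥(pbox (towerTorus Lc (fine Lc M) (n + 1))), tgrad (towerTorus Lc (fine Lc M) (n + 1)) (b.1, Sum.inl b.2) s * lam s) h
        = Matrix.diagonal (fun a : ↥(pbox M) × Fin (3 + 1) => lam (itRoot Lc M (fun _ : ℕ => ctrOff (3 + 1) Lc) (fun _ => hc) (n + 1 + 1) a.1)) * CI h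
          - CI h * Matrix.diagonal (fun b : ↥(pbox (towerTorus Lc (fine Lc M) (n + 1))) × Fin (3 + 1) => lam b.1) := fun lam h => by
    rw [hBcomm]; exact hPG₂ h lam
  -- the symmetrised split, solved for the second summand
  have h2 : 𝔔₂f v' v = (𝔔₂f v v' + 𝔔₂f v' v) - 𝔔₂f v v' := by abel
  have h2' : 𝔔₂f v v' + 𝔔₂f v' v = (2 : ℝ) • (c ^ 2 • CB (hv v) (hv v')) := by
    rw [← h𝔔₂' v v', smul_smul, show (2 : ℝ) * (1 / 2) = 1 by norm_num, one_smul]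
  -- the diagonal gauge generators commute: bring the two gauge–gauge products of the `(v′, v)` resp. `(v, v′)` expansion to the order the laws produce
  have hXX : Xbf v * Xbf v' = Xbf v' * Xbf v := by
    rw [hXbf, hXbf, Matrix.smul_mul, Matrix.smul_mul, Matrix.mul_smul, Matrix.mul_smul, Matrix.diagonal_mul_diagonal,
      Matrix.diagonal_mul_diagonal]
    exact congrArg (fun D => c • (c • D)) (congrArg Matrix.diagonal (funext fun a => mul_comm _ _))
  have hEE : -(c • Matrix.diagonal (fun b : ↥(pbox (towerTorus Lc (fine Lc M) (n + 1))) × Fin (3 + 1) => lv v' b.1)) * -(c • Matrix.diagonal (fun b : ↥(pbox (towerTorus Lc (fine Lc M) (n + 1))) × Fin (3 + 1) => lv v b.1))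
      = -(c • Matrix.diagonal (fun b : ↥(pbox (towerTorus Lc (fine Lc M) (n + 1))) × Fin (3 + 1) => lv v b.1)) * -(c • Matrix.diagonal (fun b : ↥(pbox (towerTorus Lc (fine Lc M) (n + 1))) × Fin (3 + 1) => lv v' b.1)) := by
    rw [Matrix.neg_mul, Matrix.neg_mul, Matrix.mul_neg, Matrix.mul_neg, Matrix.smul_mul, Matrix.smul_mul, Matrix.mul_smul, Matrix.mul_smul,
      Matrix.diagonal_mul_diagonal, Matrix.diagonal_mul_diagonal]
    exact congrArg (fun D => -(-(c • (c • D)))) (congrArg Matrix.diagonal (funext fun b => mul_comm _ _))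
  rw [h𝔔'₂f, h𝔔'₂f, hXX, hEE, h2, h2', hXbf, hXbf, h𝔔₁', h𝔔₁', h𝔔₀', hBaddl, hBaddr, hBaddr, hPG₂, hPG₂', hPG₂, hPG₁]
  -- name the eight atoms, then normalise (pure module algebra over `ℝ`)
  generalize Matrix.diagonal (fun a : ↥(pbox M) × Fin (3 + 1) => lv v (itRoot Lc M (fun _ : ℕ => ctrOff (3 + 1) Lc) (fun _ => hc) (n + 1 + 1) a.1)) = R
  generalize Matrix.diagonal (fun a : ↥(pbox M) × Fin (3 + 1) => lv v' (itRoot Lc M (fun _ : ℕ => ctrOff (3 + 1) Lc) (fun _ => hc) (n + 1 + 1) a.1)) = R'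
  generalize Matrix.diagonal (fun b : ↥(pbox (towerTorus Lc (fine Lc M) (n + 1))) × Fin (3 + 1) => lv v b.1) = E
  generalize Matrix.diagonal (fun b : ↥(pbox (towerTorus Lc (fine Lc M) (n + 1))) × Fin (3 + 1) => lv v' b.1) = E'
  generalize CI (hv v) = I
  generalize CI (hv v') = I'
  generalize CB (hv v) (hv v') = B
  simp only [Matrix.mul_sub, Matrix.sub_mul, Matrix.smul_mul, Matrix.mul_smul, Matrix.mul_neg, Matrix.neg_mul,
    smul_add, smul_sub, smul_neg, neg_neg, smul_smul, Matrix.mul_assoc]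
  module

end Gauge

section GaugeSym

variable (hc : ctrOff (3 + 1) Lc ∈ box (3 + 1) Lc) {κ : Type*}
  (hv : (κ → ℝ) → (↥(pbox (towerTorus Lc (fine Lc M) (n + 1))) × Fin (3 + 1) → ℝ))
  (lv : (κ → ℝ) → (↥(pbox (towerTorus Lc (fine Lc M) (n + 1))) → ℝ))
  (𝔔₀ : Matrix ((↥(pbox M) × Fin (3 + 1))) (↥(pbox (towerTorus Lc (fine Lc M) (n + 1))) × Fin (3 + 1)) ℝ)
  (h𝔔₀' : 𝔔₀ = (compRowsSym Lc M (fun i : ℕ => n + 1 - (i - 1)) (fun _ : ℕ => ctrOff (3 + 1) Lc) (n + 1 + 1) :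
      Matrix ((↥(pbox M) × Fin (3 + 1))) (↥(pbox (towerTorus Lc (fine Lc M) (n + 1))) × Fin (3 + 1)) ℝ))
  (𝔔₁f : (κ → ℝ) → Matrix ((↥(pbox M) × Fin (3 + 1))) (↥(pbox (towerTorus Lc (fine Lc M) (n + 1))) × Fin (3 + 1)) ℝ)
  (h𝔔₁' : ∀ v, 𝔔₁f v = c • compIns₁Sym Lc M (fun i : ℕ => n + 1 - (i - 1)) (fun _ : ℕ => ctrOff (3 + 1) Lc) (n + 1 + 1) (hv v))
  (𝔔₂f : (κ → ℝ) → (κ → ℝ) → Matrix ((↥(pbox M) × Fin (3 + 1))) (↥(pbox (towerTorus Lc (fine Lc M) (n + 1))) × Fin (3 + 1)) ℝ)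
  (h𝔔₂' : ∀ v v', (1 / 2 : ℝ) • (𝔔₂f v v' + 𝔔₂f v' v)
    = c ^ 2 • compIns₂₂Sym Lc M (fun i : ℕ => n + 1 - (i - 1)) (fun _ : ℕ => ctrOff (3 + 1) Lc) (n + 1 + 1) (hv v) (hv v'))
  (Xbf : (κ → ℝ) → Matrix ((↥(pbox M) × Fin (3 + 1))) ((↥(pbox M) × Fin (3 + 1))) ℝ)
  (hXbf : ∀ v, Xbf v = c • Matrix.diagonal (fun a : (↥(pbox M) × Fin (3 + 1)) =>
    lv v (itRoot Lc M (fun _ : ℕ => ctrOff (3 + 1) Lc) (fun _ => hc) (n + 1 + 1) a.1)))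
  (𝔔'₂f : (κ → ℝ) → (κ → ℝ) → Matrix ((↥(pbox M) × Fin (3 + 1))) (↥(pbox (towerTorus Lc (fine Lc M) (n + 1))) × Fin (3 + 1)) ℝ)
  (h𝔔'₂f : ∀ v v', 𝔔'₂f v v' = Xbf v * Xbf v' * 𝔔₀ + (Xbf v * 𝔔₁f v' + Xbf v * 𝔔₀ * (-(c • Matrix.diagonal (fun b : (↥(pbox (towerTorus Lc (fine Lc M) (n + 1))) × Fin (3 + 1)) => lv v' b.1))))
      + ((Xbf v * 𝔔₁f v' + Xbf v * 𝔔₀ * (-(c • Matrix.diagonal (fun b : (↥(pbox (towerTorus Lc (fine Lc M) (n + 1))) × Fin (3 + 1)) => lv v' b.1)))) + (𝔔₂f v v' + 𝔔₁f v * (-(c • Matrix.diagonal (fun b : (↥(pbox (towerTorus Lc (fine Lc M) (n + 1))) × Fin (3 + 1)) => lv v' b.1))) + (𝔔₁f v * (-(c • Matrix.diagonal (fun b : (↥(pbox (towerTorus Lc (fine Lc M) (n + 1))) × Fin (3 + 1)) => lv v' b.1))) + 𝔔₀ * ((-(c • Matrix.diagonal (fun b : (↥(pbox (towerTorus Lc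 (fine Lc M) (n + 1))) × Fin (3 + 1)) => lv v b.1))) * (-(c • Matrix.diagonal (fun b : (↥(pbox (towerTorus Lc (fine Lc M) (n + 1))) × Fin (3 + 1)) => lv v' b.1))))))))

include h𝔔₀' h𝔔₁' h𝔔₂' hXbf h𝔔'₂f in
/-- [folklore] **`Qprime2_symm_eq_compIns22Sym_along_sums`**: with `Xbf` so instantiated, an2 g66 `TorusCompositeIndexWardOneSym.compIns₁Sym_pureGauge_fun` (order 1), an2 g67
`TorusCompositeIndexWardTwoSym.compIns₂₂Sym_pureGauge_snd` (order 2) and leaf-02 TwoPolar-Sym's `compIns₂₂Sym_add_left ∕ _add_right ∕ _comm` turn v4's `h𝔔′₂f`, symmetrised,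
into `½ • (𝔔′₂f v v′ + 𝔔′₂f v′ v) = c² • compIns₂₂Sym … (n+2) (hv v + tgrad·lv v) (hv v′ + tgrad·lv v′)` — at order 2, too, the conjugation is exactly what completes each
direction by its exact mode (NO gauge residue). -/
theorem Qprime2_symm_eq_compIns22Sym_along_sums (v v' : κ → ℝ) :
    (1 / 2 : ℝ) • (𝔔'₂f v v' + 𝔔'₂f v' v)
      = c ^ 2 • compIns₂₂Sym Lc M (fun i : ℕ => n + 1 - (i - 1)) (fun _ : ℕ => ctrOff (3 + 1) Lc) (n + 1 + 1)
          (hv v + fun b : ↥(pbox (towerTorus Lc (fine Lc M) (n + 1))) × Fin (3 + 1) =>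
            ∑ s : ↥(pbox (towerTorus Lc (fine Lc M) (n + 1))), tgrad (towerTorus Lc (fine Lc M) (n + 1)) (b.1, Sum.inl b.2) s * lv v s)
          (hv v' + fun b : ↥(pbox (towerTorus Lc (fine Lc M) (n + 1))) × Fin (3 + 1) =>
            ∑ s : ↥(pbox (towerTorus Lc (fine Lc M) (n + 1))), tgrad (towerTorus Lc (fine Lc M) (n + 1)) (b.1, Sum.inl b.2) s * lv v' s) :=
  Qprime2_symm_eq_bijet_along_sums_of_pureGauge M n c hc hv lv 𝔔₀ _ h𝔔₀'
    (fun h => compIns₁Sym Lc M (fun i : ℕ => n + 1 - (i - 1)) (fun _ : ℕ => ctrOff (3 + 1) Lc) (n + 1 + 1) h)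
    𝔔₁f h𝔔₁'
    (fun h h' => compIns₂₂Sym Lc M (fun i : ℕ => n + 1 - (i - 1)) (fun _ : ℕ => ctrOff (3 + 1) Lc) (n + 1 + 1) h h')
    𝔔₂f h𝔔₂' Xbf hXbf 𝔔'₂f h𝔔'₂f
    (fun lam => compIns₁Sym_pureGauge_fun Lc hc (n + 1 + 1) M (fun i : ℕ => n + 1 - (i - 1)) (fun _ : ℕ => ctrOff (3 + 1) Lc) lam)
    (fun h lam => compIns₂₂Sym_pureGauge_snd Lc hc (n + 1 + 1) M (fun i : ℕ => n + 1 - (i - 1)) (fun _ : ℕ => ctrOff (3 + 1) Lc) h lam)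
    (fun h₁ h₂ h' => compIns₂₂Sym_add_left Lc (n + 1 + 1) M (fun i : ℕ => n + 1 - (i - 1)) (fun _ : ℕ => ctrOff (3 + 1) Lc) h₁ h₂ h')
    (fun h h₁ h₂ => compIns₂₂Sym_add_right Lc hc (n + 1 + 1) M (fun i : ℕ => n + 1 - (i - 1)) (fun _ : ℕ => ctrOff (3 + 1) Lc) h h₁ h₂)
    (fun h h' => compIns₂₂Sym_comm Lc hc (n + 1 + 1) M (fun i : ℕ => n + 1 - (i - 1)) (fun _ : ℕ => ctrOff (3 + 1) Lc) h h') v v'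

end GaugeSym

/-! ## §3 Along two pinned directions: the bi-jet along the two torus ℋ-columns -/

section Direction

variable (hc : ctrOff (3 + 1) Lc ∈ box (3 + 1) Lc) {κ : Type*} [DecidableEq κ] (yN : κ → Site (3 + 1)) (μN : κ → Fin (3 + 1))
  (hv : (κ → ℝ) → (↥(pbox (towerTorus Lc (fine Lc M) (n + 1))) × Fin (3 + 1) → ℝ))
  (hhvl : ∀ (r : ℝ) (x y : κ → ℝ), hv (r • x + y) = r • hv x + hv y)
  (lv : (κ → ℝ) → ↥(pbox (towerTorus Lc (fine Lc M) (n + 1))) → ℝ)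
  (hlv : ∀ (r : ℝ) (x y : κ → ℝ), lv (r • x + y) = r • lv x + lv y)
  -- (J-W″) at `r := 1` (g39 #5 at the pins, as `TowerHN1Row` ∕ `TowerQN1RowJet`)
  (hJW : ∀ (a : κ) (b : ↥(pbox (towerTorus Lc (fine Lc M) (n + 1))) × Fin (3 + 1)), hv (Pi.single a 1) b
      = perF (towerTorus Lc (fine Lc M) (n + 1)) (AN (Roots.ctr Lc) (n + 1)) (b.1, Sum.inl b.2)
          (wrapPt (towerTorus Lc (fine Lc M) (n + 1)) (((Lc ^ (n + 1 + 1) : ℕ) : ℤ) • yN a), Sum.inr (μN a))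
        - ∑ s : ↥(pbox (towerTorus Lc (fine Lc M) (n + 1))), tgrad (towerTorus Lc (fine Lc M) (n + 1)) (b.1, Sum.inl b.2) s * lv (Pi.single a 1) s)
  (𝔔₀ : Matrix ((↥(pbox M) × Fin (3 + 1))) (↥(pbox (towerTorus Lc (fine Lc M) (n + 1))) × Fin (3 + 1)) ℝ)
  (h𝔔₀' : 𝔔₀ = (compRowsSym Lc M (fun i : ℕ => n + 1 - (i - 1)) (fun _ : ℕ => ctrOff (3 + 1) Lc) (n + 1 + 1) :
      Matrix ((↥(pbox M) × Fin (3 + 1))) (↥(pbox (towerTorus Lc (fine Lc M) (n + 1))) × Fin (3 + 1)) ℝ))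
  (𝔔₁f : (κ → ℝ) → Matrix ((↥(pbox M) × Fin (3 + 1))) (↥(pbox (towerTorus Lc (fine Lc M) (n + 1))) × Fin (3 + 1)) ℝ)
  (h𝔔₁' : ∀ v, 𝔔₁f v = c • compIns₁Sym Lc M (fun i : ℕ => n + 1 - (i - 1)) (fun _ : ℕ => ctrOff (3 + 1) Lc) (n + 1 + 1) (hv v))
  (𝔔₂f : (κ → ℝ) → (κ → ℝ) → Matrix ((↥(pbox M) × Fin (3 + 1))) (↥(pbox (towerTorus Lc (fine Lc M) (n + 1))) × Fin (3 + 1)) ℝ)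
  (h𝔔₂' : ∀ v v', (1 / 2 : ℝ) • (𝔔₂f v v' + 𝔔₂f v' v) = c ^ 2 • compIns₂₂Sym Lc M (fun i : ℕ => n + 1 - (i - 1)) (fun _ : ℕ => ctrOff (3 + 1) Lc) (n + 1 + 1) (hv v) (hv v'))
  (Xbf : (κ → ℝ) → Matrix ((↥(pbox M) × Fin (3 + 1))) ((↥(pbox M) × Fin (3 + 1))) ℝ)
  (hXbf : ∀ v, Xbf v = c • Matrix.diagonal (fun a : (↥(pbox M) × Fin (3 + 1)) =>
    lv v (itRoot Lc M (fun _ : ℕ => ctrOff (3 + 1) Lc) (fun _ => hc) (n + 1 + 1) a.1)))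
  (𝔔'₂f : (κ → ℝ) → (κ → ℝ) → Matrix ((↥(pbox M) × Fin (3 + 1))) (↥(pbox (towerTorus Lc (fine Lc M) (n + 1))) × Fin (3 + 1)) ℝ)
  (h𝔔'₂f : ∀ v v', 𝔔'₂f v v' = Xbf v * Xbf v' * 𝔔₀ + (Xbf v * 𝔔₁f v' + Xbf v * 𝔔₀ * (-(c • Matrix.diagonal (fun b : (↥(pbox (towerTorus Lc (fine Lc M) (n + 1))) × Fin (3 + 1)) => lv v' b.1))))
      + ((Xbf v * 𝔔₁f v' + Xbf v * 𝔔₀ * (-(c • Matrix.diagonal (fun b : (↥(pbox (towerTorus Lc (fine Lc M) (n + 1))) × Fin (3 + 1)) => lv v' b.1)))) + (𝔔₂f v v' + 𝔔₁f v * (-(c • Matrix.diagonal (fun b : (↥(pbox (towerTorus Lc (fine Lc M) (n + 1))) × Fin (3 + 1)) => lv v' b.1))) + (𝔔₁f v * (-(c • Matrix.diagonal (fun b : (↥(pbox (towerTorus Lc (fine Lc M) (n + 1))) × Fin (3 + 1)) => lv v' b.1))) + 𝔔₀ * ((-(c • Matrix.diagonal (fun b : (↥(pbox (towerTorus Lc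 (fine Lc M) (n + 1))) × Fin (3 + 1)) => lv v b.1))) * (-(c • Matrix.diagonal (fun b : (↥(pbox (towerTorus Lc (fine Lc M) (n + 1))) × Fin (3 + 1)) => lv v' b.1))))))))
  (r : ℝ) (a a' : κ)

include hhvl hlv hJW h𝔔₀' h𝔔₁' h𝔔₂' hXbf h𝔔'₂f in
/-- [folklore] **`Qprime2_symm_eq_smul_compIns22Sym_cols`**: along two pinned directions `r•e_a`, `r•e_{a′}` the wrapper's symmetrised conjugated second jet IS `(c²·r·r) •` the
(n+2)-fold composite bi-jet along the two torus ℋ-columns of the sources `a`, `a′` (§2 + `TowerQN1RowJet.direction_add_exact_eq_smul_col` twice + leaf-02's homogeneity in each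
weight, READ at the wrapper's spelling of the finest torus). -/
theorem Qprime2_symm_eq_smul_compIns22Sym_cols :
    (1 / 2 : ℝ) • (𝔔'₂f (r • (Pi.single a (1 : ℝ) : κ → ℝ)) (r • (Pi.single a' (1 : ℝ) : κ → ℝ))
        + 𝔔'₂f (r • (Pi.single a' (1 : ℝ) : κ → ℝ)) (r • (Pi.single a (1 : ℝ) : κ → ℝ)))
      = (c ^ 2 * r * r) • compIns₂₂Sym Lc M (fun i : ℕ => n + 1 - (i - 1)) (fun _ : ℕ => ctrOff (3 + 1) Lc) (n + 1 + 1)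
          (fun b : ↥(pbox (towerTorus Lc (fine Lc M) (n + 1))) × Fin (3 + 1) =>
            perF (towerTorus Lc (fine Lc M) (n + 1)) (AN (Roots.ctr Lc) (n + 1)) (b.1, Sum.inl b.2)
              (wrapPt (towerTorus Lc (fine Lc M) (n + 1)) (((Lc ^ (n + 1 + 1) : ℕ) : ℤ) • yN a), Sum.inr (μN a)))
          (fun b : ↥(pbox (towerTorus Lc (fine Lc M) (n + 1))) × Fin (3 + 1) =>
            perF (towerTorus Lc (fine Lc M) (n + 1)) (AN (Roots.ctr Lc) (n + 1)) (b.1, Sum.inl b.2)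
              (wrapPt (towerTorus Lc (fine Lc M) (n + 1)) (((Lc ^ (n + 1 + 1) : ℕ) : ℤ) • yN a'), Sum.inr (μN a'))) := by
  rw [Qprime2_symm_eq_compIns22Sym_along_sums M n c hc hv lv 𝔔₀ h𝔔₀' 𝔔₁f h𝔔₁' 𝔔₂f h𝔔₂' Xbf hXbf 𝔔'₂f h𝔔'₂f,
    direction_add_exact_eq_smul_col M n yN μN hv hhvl lv hlv hJW r a, direction_add_exact_eq_smul_col M n yN μN hv hhvl lv hlv hJW r a']
  -- leaf-02's homogeneity of the bi-jet in each weight, READ at the wrapper's spelling of the finest torus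
  have hsl : ∀ h h' : ↥(pbox (towerTorus Lc (fine Lc M) (n + 1))) × Fin (3 + 1) → ℝ,
      compIns₂₂Sym Lc M (fun i : ℕ => n + 1 - (i - 1)) (fun _ : ℕ => ctrOff (3 + 1) Lc) (n + 1 + 1) (r • h) h' = r • compIns₂₂Sym Lc M (fun i : ℕ => n + 1 - (i - 1)) (fun _ : ℕ => ctrOff (3 + 1) Lc) (n + 1 + 1) h h' :=
    fun h h' => compIns₂₂Sym_smul_left Lc (n + 1 + 1) M (fun i : ℕ => n + 1 - (i - 1)) (fun _ : ℕ => ctrOff (3 + 1) Lc) r h h'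
  have hsr : ∀ h h' : ↥(pbox (towerTorus Lc (fine Lc M) (n + 1))) × Fin (3 + 1) → ℝ,
      compIns₂₂Sym Lc M (fun i : ℕ => n + 1 - (i - 1)) (fun _ : ℕ => ctrOff (3 + 1) Lc) (n + 1 + 1) h (r • h') = r • compIns₂₂Sym Lc M (fun i : ℕ => n + 1 - (i - 1)) (fun _ : ℕ => ctrOff (3 + 1) Lc) (n + 1 + 1) h h' :=
    fun h h' => compIns₂₂Sym_smul_right Lc hc (n + 1 + 1) M (fun i : ℕ => n + 1 - (i - 1)) (fun _ : ℕ => ctrOff (3 + 1) Lc) r h h'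
  rw [hsl, hsr, smul_smul, smul_smul]

end Direction

end Summit.QuantumFields.BalabanUV.Beta.FP.TowerQN2RowJet

end
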